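import Summits.KontsevichZagierPeriods.KontsevichZagierPeriods.Theorems.RealOnePeriodRelations.Negative.Kit
import Literature.NumberTheory.Transcendental.KZSubcalculusInvariants

/-!
# `RealOnePeriodRelations` (stmt-KontsevichZagierPeriods-10042) — negative side: the conclusion
# subgroup `M₁` is torsion-free-saturated, so the crux equals its "up to an integer multiple" form

Structural facts about `M₁ = closure (1a ∪ 1b ∪ 2 ∪ Green)` used on both sides of the crux
`∀ c ∈ H₁, eval c = 0 → c ∈ M₁`, built on the tree's scaling endomorphism `KZ.scale a ha`
(`KZRelationsLE`: `[σ, f] ↦ [σ, a·f]` for a real algebraic `a`; it preserves 1a, 1b, 2) and the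
integrand-additivity bookkeeping `KZ.IntegralRep.of_constMul_nat_sub_nsmul_mem`
(`KZSubcalculusInvariants`: `[σ, k·f] − k•[σ, f] ∈ closure (1b)`):

* `scale_mem_greenSet`: scaling maps Green instances to Green instances (data `(aA, aB, aS)`), hence
  `scale_mem_M₁`: `M₁` is stable under every `KZ.scale a ha`.
* `sub_nsmul_scale_inv_mem`: `c − n • scale (1/n) c ∈ closure (1b)` for every `c` and `n ≥ 1`.
* `M₁_torsionFree` (`_int`): `n • c ∈ M₁ → c ∈ M₁` for `n ≠ 0` — `FormalRep ⧸ M₁` is TORSION-FREE;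
  and `realOnePeriodRelations_iff_upToMultiples`: the crux is EQUIVALENT to putting SOME non-zero
  integer multiple of each vanishing 1-dimensional combination into `M₁` (rational certificates may
  be cleared of denominators).
This is the refuter's check that the route's informal step "`H₁/M₁` is a `(ℚ̄ ∩ ℝ)`-space through 1b,
hence torsion-free" hides no divisibility / additive-section assumption (cf.
`Theorems/NoriTransferRefutations`): it is a theorem of the calculus. [Kontsevich–Zagier 2001, §1.2]
-/

noncomputable section

open scoped BigOperators Topology
open Set MeasureTheory Filter
open Literature.NumberTheory.Transcendental

namespace Summit.KontsevichZagierPeriods.SymplecticScissors.RealOnePeriodRelationsNegative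

/-! ## `KZ.scale` preserves the Green generator, hence `M₁` -/

/-- Scaling by a real algebraic constant maps Green instances to Green instances: data
`(a·A, a·B, a·S)` (semialgebraic: product with a `ℚ`-definable constant; continuous; `d(aS) = a dS`).
[cite: KontsevichZagier2001, §1.2] -/
theorem scale_mem_greenSet (a : ℝ) (ha : IsAlgebraic ℚ a) {c : KZ.FormalRep} (hc : c ∈ greenSet) :
    KZ.scale a ha c ∈ greenSet := by
  obtain ⟨Δ', A, B, S, r₀₁, r₁₂, r₀₂, hΔ, hA, hB, hAc, hBc, hS, hd₁, hd₂, hd₃, hi₁, hi₂, hi₃, rfl⟩ := hc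
  have hΔs : Literature.ModelTheory.ExponentialFields.IsSemialgebraic ℚ Δ' :=
    IsSemialgebraicFunOn.isSemialgebraic_holds hA
  refine ⟨Δ', fun p => a * A p, fun p => a * B p, fun p => a * S p,
    r₀₁.constMul a ha, r₁₂.constMul a ha, r₀₂.constMul a ha, hΔ,
    IsSemialgebraicFunOn.mul_holds (isSemialgebraicFunOn_const_of_isAlgebraic hΔs ha) hA,
    IsSemialgebraicFunOn.mul_holds (isSemialgebraicFunOn_const_of_isAlgebraic hΔs ha) hB,
    continuousOn_const.mul hAc, continuousOn_const.mul hBc, ?_, hd₁, hd₂, hd₃, ?_, ?_, ?_,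
    by simp [map_sub, map_add]⟩
  · intro p h0 h1 h2
    have h := (hS p h0 h1 h2).const_smul a
    refine h.congr_fderiv ?_
    simp only [smul_add, smul_smul]
  · intro z hz
    simp [hi₁ z hz]
  · intro z hz
    simp [hi₂ z hz, mul_sub]
  · intro z hz
    simp [hi₃ z hz]

/-- **`M₁` is stable under scaling of integrands by real algebraic constants** (1a, 1b, 2 by the
tree's `KZ.scale_mem_*`, Green by `scale_mem_greenSet`). [cite: KontsevichZagier2001, §1.2] -/
theorem scale_mem_M₁ (a : ℝ) (ha : IsAlgebraic ℚ a) {c : KZ.FormalRep} (hc : c ∈ M₁) :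
    KZ.scale a ha c ∈ M₁ := by
  have h : M₁ ≤ M₁.comap (KZ.scale a ha) := by
    refine (AddSubgroup.closure_le _).mpr ?_
    rintro c (((hc | hc) | hc) | hc)
    · exact AddSubgroup.subset_closure (Or.inl (Or.inl (Or.inl (KZ.scale_mem_domainAddRel a ha hc))))
    · exact AddSubgroup.subset_closure (Or.inl (Or.inl (Or.inr (KZ.scale_mem_integrandAddRel a ha hc))))
    · exact AddSubgroup.subset_closure (Or.inl (Or.inr (KZ.scale_mem_changeOfVariablesRel a ha hc)))
    · exact AddSubgroup.subset_closure (Or.inr (scale_mem_greenSet a ha hc))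
  exact h hc

/-! ## Divisibility from integrand additivity alone -/

/-- `closure (1b) ≤ M₁`. [folklore] -/
theorem closure_integrandAddRel_le_M₁ : AddSubgroup.closure KZ.integrandAddRel ≤ M₁ :=
  AddSubgroup.closure_mono fun _ hc => Or.inl (Or.inl (Or.inr hc))

/-- `n⁻¹` is algebraic. [folklore] -/
theorem isAlgebraic_inv_nat (n : ℕ) : IsAlgebraic ℚ ((n : ℝ)⁻¹) := (isAlgebraic_nat n).inv

/-- For a generator: `[s] − [n · (n⁻¹ · s)] ∈ closure (1b)` (`n ≠ 0`; the instance
`[s] − [n·(n⁻¹·s)] − [0·s]` plus `[0·s] ∈ closure (1b)`). [cite: KontsevichZagier2001, §1.2 rule (1)] -/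
theorem of_sub_of_constMul_constMul_mem {m : ℕ} (s : KZ.IntegralRep m) {n : ℕ} (hn : n ≠ 0) :
    KZ.of s - KZ.of ((s.constMul ((n : ℝ)⁻¹) (isAlgebraic_inv_nat n)).constMul (n : ℝ) (isAlgebraic_nat n)) ∈
      AddSubgroup.closure KZ.integrandAddRel := by
  have hn' : (n : ℝ) ≠ 0 := Nat.cast_ne_zero.mpr hn
  have h1 : KZ.of s - KZ.of ((s.constMul ((n : ℝ)⁻¹) (isAlgebraic_inv_nat n)).constMul (n : ℝ)
      (isAlgebraic_nat n)) - KZ.of (s.constMul ((0 : ℕ) : ℝ) (isAlgebraic_nat 0)) ∈ KZ.integrandAddRel := by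
    refine ⟨m, s, (s.constMul ((n : ℝ)⁻¹) (isAlgebraic_inv_nat n)).constMul (n : ℝ) (isAlgebraic_nat n),
      s.constMul ((0 : ℕ) : ℝ) (isAlgebraic_nat 0), rfl, rfl, ?_, rfl⟩
    intro x _
    simp only [KZ.IntegralRep.integrand_constMul, Pi.add_apply]
    push_cast
    rw [zero_mul, add_zero, ← mul_assoc, mul_inv_cancel₀ hn', one_mul]
  have h2 := (AddSubgroup.closure KZ.integrandAddRel).add_mem (AddSubgroup.subset_closure h1)
    (s.of_constMul_zero_mem_closure_integrandAddRel)
  simpa using h2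

/-- DIVISIBILITY IDENTITY: `c − n • scale (n⁻¹) c ∈ closure (1b)` for every formal combination `c`
and every `n ≥ 1` (on generators: the previous lemma plus the tree's
`[n·r] − n•[r] ∈ closure (1b)` for `r = n⁻¹·s`). [cite: KontsevichZagier2001, §1.2 rule (1)] -/
theorem sub_nsmul_scale_inv_mem (n : ℕ) (hn : n ≠ 0) (c : KZ.FormalRep) :
    c - n • KZ.scale ((n : ℝ)⁻¹) (isAlgebraic_inv_nat n) c ∈ AddSubgroup.closure KZ.integrandAddRel := by
  induction c using FreeAbelianGroup.induction_on with
  | zero => simp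
  | of x =>
    obtain ⟨m, s⟩ := x
    change KZ.of s - n • KZ.scale ((n : ℝ)⁻¹) (isAlgebraic_inv_nat n) (KZ.of s) ∈ _
    rw [KZ.scale_of]
    have h1 := of_sub_of_constMul_constMul_mem s hn
    have h2 := (s.constMul ((n : ℝ)⁻¹) (isAlgebraic_inv_nat n)).of_constMul_nat_sub_nsmul_mem n
    have h3 := (AddSubgroup.closure KZ.integrandAddRel).add_mem h1 h2
    simpa using h3
  | neg x ih =>
    have h := (AddSubgroup.closure KZ.integrandAddRel).neg_mem ih
    simpa [smul_neg, neg_sub, sub_eq_add_neg, add_comm] using h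
  | add x y hx hy =>
    have h := (AddSubgroup.closure KZ.integrandAddRel).add_mem hx hy
    convert h using 1
    simp only [map_add, smul_add]
    abel

/-! ## Torsion-freeness of `FormalRep ⧸ M₁` and the crux up to multiples -/

/-- **`FormalRep ⧸ M₁` is torsion-free**: if `n • c ∈ M₁` with `n ≠ 0` then `c ∈ M₁`
(`c = (c − n • scale (n⁻¹) c) + scale (n⁻¹) (n • c)`). [cite: KontsevichZagier2001, §1.2] -/
theorem M₁_torsionFree {n : ℕ} (hn : n ≠ 0) {c : KZ.FormalRep} (h : n • c ∈ M₁) : c ∈ M₁ := by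
  have h1 : KZ.scale ((n : ℝ)⁻¹) (isAlgebraic_inv_nat n) (n • c) ∈ M₁ := scale_mem_M₁ _ _ h
  rw [map_nsmul] at h1
  have h2 : c - n • KZ.scale ((n : ℝ)⁻¹) (isAlgebraic_inv_nat n) c ∈ M₁ :=
    closure_integrandAddRel_le_M₁ (sub_nsmul_scale_inv_mem n hn c)
  have h3 : c = (c - n • KZ.scale ((n : ℝ)⁻¹) (isAlgebraic_inv_nat n) c) +
      n • KZ.scale ((n : ℝ)⁻¹) (isAlgebraic_inv_nat n) c := by abel
  rw [h3]
  exact M₁.add_mem h2 h1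

/-- Integer version of torsion-freeness. [cite: KontsevichZagier2001, §1.2] -/
theorem M₁_torsionFree_int {k : ℤ} (hk : k ≠ 0) {c : KZ.FormalRep} (h : k • c ∈ M₁) : c ∈ M₁ := by
  have hn : k.natAbs ≠ 0 := Int.natAbs_ne_zero.mpr hk
  refine M₁_torsionFree hn ?_
  rcases Int.natAbs_eq k with hk' | hk'
  · have : (k.natAbs : ℤ) • c = k • c := by rw [← hk']
    rw [← natCast_zsmul, this]
    exact h
  · have : (k.natAbs : ℤ) • c = -(k • c) := by
      rw [← neg_zsmul]
      congr 1
      omega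
    rw [← natCast_zsmul, this]
    exact M₁.neg_mem h

/-- **The crux is equivalent to its up-to-multiples form**: it suffices to put SOME non-zero
integer multiple of each vanishing 1-dimensional combination into `M₁`.
[cite: HuberWustholz2022, Thm 13.3 (2)] -/
theorem realOnePeriodRelations_iff_upToMultiples :
    Summit.KontsevichZagierPeriods.KontsevichZagierPeriods.Theses.SymplecticScissors.RealOnePeriodRelations ↔
      ∀ c : KZ.FormalRep, c ∈ H₁ → KZ.eval c = 0 → ∃ n : ℕ, n ≠ 0 ∧ n • c ∈ M₁ := by
  rw [crux_iff]
  constructor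
  · intro h c hc h0
    exact ⟨1, one_ne_zero, by simpa using h c hc h0⟩
  · intro h c hc h0
    obtain ⟨n, hn, hmem⟩ := h c hc h0
    exact M₁_torsionFree hn hmem

end Summit.KontsevichZagierPeriods.SymplecticScissors.RealOnePeriodRelationsNegative

end
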